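import Summits.Ventures.PercRepro.NullityCircuitsB
import Summits.Ventures.PercRepro.RankLevelSetCoreSparse

/-!
# PercRepro — the triangles through a point are at most the nullity, under (C1) (night-1, gen 1; dossier §13.4 (R1⁗))

In a finite matroid in which every rank-`2` set has at most `3` elements ((C1), the core property), two distinct
`3`-element circuits through a point `x` meet only in `x`; so `t` triangles through `x` cover `1 + 2t` points of rank
`≤ 1 + t`, a set of nullity `≥ t`. Hence the number of triangles through `x` is at most the nullity `|E| − r(E)`. This is
the rigorous form of the «contraction» bound `s₃ ≤ |T|·ν/3` of the dossier (no contraction is used: submodularity only).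

* `trianglesThrough M x` — the `3`-element circuits through `x`;
* `inter_eq_singleton_of_mem_trianglesThrough` — two distinct triangles through `x` meet exactly in `{x}`;
* `eRk_le_and_ncard_eq_of_triangles` — `t` triangles through `x` cover `1 + 2t` points of rank `≤ 1 + t`;
* **`ncard_trianglesThrough_le`** — `#(triangles through x) ≤ d` when `|E| = r(E) + d`;
* **`three_mul_ncard_triangles_le`** — the double count `3·s₃ ≤ |⋃ triangles|·d` (with `|⋃ circuitsLE 3| ≤ 3d` this is
  the dossier's `s₃ ≤ ν²`);
* **`ncard_triangles_le_sq`** — `s₃ ≤ d²` (Corollary N′ of NullityCircuitsB supplies `|⋃ circuitsLE 3| ≤ 3d`);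
* **`ncard_triangles_subset_le_sq`** — the same for the triangles inside a subset `S` with `|S| = r(S) + ν(S)` (restriction);
* `core_ncard_triangles_subset_le_sq` — the form on the wrapper's core, (C1) supplied by `ncard_le_three_of_eRk_two`.
Axioms: standard.
-/

namespace PercRepro

namespace ThmN

open Set

variable {α : Type}

/-- The triangles (circuits with exactly `3` elements) of `M` through the point `x`. -/
def trianglesThrough (M : Matroid α) (x : α) : Set (Set α) :=
  {C : Set α | M.IsCircuit C ∧ C.ncard = 3 ∧ x ∈ C}

/-- A triangle has rank `2`. -/
theorem eRk_eq_two_of_mem_trianglesThrough (M : Matroid α) [M.Finite] {x : α} {C : Set α}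
    (hC : C ∈ trianglesThrough M x) : M.eRk C = 2 := by
  obtain ⟨hC, hC3, -⟩ := hC
  have hfin : C.Finite := M.ground_finite.subset hC.subset_ground
  have h := hC.eRk_add_one_eq
  rw [← hfin.cast_ncard_eq, hC3] at h
  have hne : M.eRk C ≠ ⊤ := ((M.eRk_le_encard _).trans_lt hfin.encard_lt_top).ne
  obtain ⟨r, hr⟩ := ENat.ne_top_iff_exists.1 hne
  rw [← hr] at h ⊢
  have h' : r + 1 = 3 := by exact_mod_cast h
  have : r = 2 := by omega
  rw [this]
  norm_num

/-- **Two distinct triangles through `x` meet only in `x`** under (C1): a common second point `a` would put both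
inside the line `cl {x, a}`, which would then have `≥ 4` points. -/
theorem inter_eq_singleton_of_mem_trianglesThrough (M : Matroid α) [M.Finite]
    (hC1 : ∀ L ⊆ M.E, M.eRk L = 2 → L.ncard ≤ 3) {x : α} {C C' : Set α}
    (hC : C ∈ trianglesThrough M x) (hC' : C' ∈ trianglesThrough M x) (hne : C ≠ C') : C ∩ C' = {x} := by
  have hCE : C ⊆ M.E := hC.1.subset_ground
  have hC'E : C' ⊆ M.E := hC'.1.subset_ground
  have hCfin : C.Finite := M.ground_finite.subset hCE
  have hC'fin : C'.Finite := M.ground_finite.subset hC'E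
  have hr : M.eRk C = 2 := eRk_eq_two_of_mem_trianglesThrough M hC
  have hr' : M.eRk C' = 2 := eRk_eq_two_of_mem_trianglesThrough M hC'
  apply Set.Subset.antisymm
  · intro a ha
    by_contra hax
    have hax' : a ≠ x := fun h => hax (h ▸ Set.mem_singleton a)
    -- the pair `{x, a}` is independent (a proper subset of a circuit), of rank `2`
    have hpairC : ({x, a} : Set α) ⊆ C := by
      intro z hz
      rcases hz with rfl | rfl
      · exact hC.2.2
      · exact ha.1
    have hpairC' : ({x, a} : Set α) ⊆ C' := by
      intro z hz
      rcases hz with rfl | rfl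
      · exact hC'.2.2
      · exact ha.2
    have hpair_ssub : ({x, a} : Set α) ⊂ C := by
      refine hpairC.ssubset_of_ne ?_
      intro h
      have := congrArg Set.ncard h
      rw [Set.ncard_pair (Ne.symm hax'), hC.2.1] at this
      omega
    have hpair_indep : M.Indep ({x, a} : Set α) := hC.1.ssubset_indep hpair_ssub
    have hpair_rk : M.eRk ({x, a} : Set α) = 2 := by
      rw [hpair_indep.eRk_eq_encard, Set.encard_pair (Ne.symm hax')]
    -- both triangles lie in `cl {x, a}`
    have hCcl : C ⊆ M.closure ({x, a} : Set α) :=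
      subset_closure_of_eRk_le M hpairC hCE hCfin (by rw [hr, hpair_rk])
    have hC'cl : C' ⊆ M.closure ({x, a} : Set α) :=
      subset_closure_of_eRk_le M hpairC' hC'E hC'fin (by rw [hr', hpair_rk])
    have hU : M.eRk (C ∪ C') = 2 := by
      apply le_antisymm
      · calc M.eRk (C ∪ C') ≤ M.eRk (M.closure ({x, a} : Set α)) :=
              M.eRk_mono (Set.union_subset hCcl hC'cl)
          _ = 2 := by rw [M.eRk_closure_eq, hpair_rk]
      · rw [← hr]; exact M.eRk_mono Set.subset_union_left
    have h3 := hC1 (C ∪ C') (Set.union_subset hCE hC'E) hU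
    -- but `C ∪ C'` has `≥ 4` elements
    have hC'notsub : ¬ C' ⊆ C := by
      intro hsub
      exact hne (Set.eq_of_subset_of_ncard_le hsub (by rw [hC.2.1, hC'.2.1]) hCfin).symm
    obtain ⟨b, hbC', hbC⟩ := Set.not_subset.1 hC'notsub
    have h4 : 4 ≤ (C ∪ C').ncard := by
      have hins : insert b C ⊆ C ∪ C' := Set.insert_subset (Set.mem_union_right C hbC') Set.subset_union_left
      have := Set.ncard_le_ncard hins (hCfin.union hC'fin)
      rw [Set.ncard_insert_of_notMem hbC hCfin, hC.2.1] at this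
      exact this
    omega
  · intro z hz
    rw [Set.mem_singleton_iff.1 hz]
    exact ⟨hC.2.2, hC'.2.2⟩

/-- **`t` triangles through `x` cover `1 + 2t` points of rank `≤ 1 + t`** (induction on the finite set of triangles,
submodularity at each step; (C1) makes the new triangle meet the old union only in `x`). -/
theorem eRk_le_and_ncard_eq_of_triangles (M : Matroid α) [M.Finite]
    (hC1 : ∀ L ⊆ M.E, M.eRk L = 2 → L.ncard ≤ 3) {x : α} (hx : M.IsNonloop x)
    (s : Finset (Set α)) (hs : ∀ C ∈ s, C ∈ trianglesThrough M x) :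
    M.eRk ({x} ∪ ⋃ C ∈ s, C) ≤ ((1 + s.card : ℕ) : ℕ∞) ∧
      ({x} ∪ ⋃ C ∈ s, C).ncard = 1 + 2 * s.card := by
  classical
  induction s using Finset.induction_on with
  | empty =>
    simp only [Finset.notMem_empty, Set.iUnion_of_empty, Set.iUnion_empty, Set.union_empty,
      Finset.card_empty, Nat.cast_one, add_zero, mul_zero]
    exact ⟨by rw [hx.eRk_eq], Set.ncard_singleton x⟩
  | insert C₀ s hC₀s ih =>
    have hs' : ∀ C ∈ s, C ∈ trianglesThrough M x := fun C hC => hs C (Finset.mem_insert_of_mem hC)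
    obtain ⟨ihr, ihc⟩ := ih hs'
    have hC₀ : C₀ ∈ trianglesThrough M x := hs C₀ (Finset.mem_insert_self C₀ s)
    set U : Set α := {x} ∪ ⋃ C ∈ s, C with hU
    have hxU : x ∈ U := Set.mem_union_left _ (Set.mem_singleton x)
    have hUE : U ⊆ M.E := by
      intro z hz
      rcases hz with hz | hz
      · rw [Set.mem_singleton_iff.1 hz]; exact hx.mem_ground
      · obtain ⟨C, hC, hzC⟩ := Set.mem_iUnion₂.1 hz
        exact (hs' C hC).1.subset_ground hzC
    have hUfin : U.Finite := M.ground_finite.subset hUE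
    have hC₀E : C₀ ⊆ M.E := hC₀.1.subset_ground
    have hC₀fin : C₀.Finite := M.ground_finite.subset hC₀E
    have hnew : {x} ∪ ⋃ C ∈ insert C₀ s, C = C₀ ∪ U := by
      rw [hU, Finset.set_biUnion_insert]
      ext z
      simp only [Set.mem_union, Set.mem_singleton_iff]
      constructor
      · rintro (h | h | h)
        · exact Or.inr (Or.inl h)
        · exact Or.inl h
        · exact Or.inr (Or.inr h)
      · rintro (h | h | h)
        · exact Or.inr (Or.inl h)
        · exact Or.inl h
        · exact Or.inr (Or.inr h)
    -- `C₀ ∩ U = {x}`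
    have hinter : C₀ ∩ U = {x} := by
      apply Set.Subset.antisymm
      · rintro z ⟨hzC₀, hzU⟩
        rcases hzU with hz | hz
        · exact hz
        · obtain ⟨C, hC, hzC⟩ := Set.mem_iUnion₂.1 hz
          have hne : C₀ ≠ C := fun h => hC₀s (h ▸ hC)
          have := inter_eq_singleton_of_mem_trianglesThrough M hC1 hC₀ (hs' C hC) hne
          rw [← this]
          exact ⟨hzC₀, hzC⟩
      · intro z hz
        rw [Set.mem_singleton_iff.1 hz]
        exact ⟨hC₀.2.2, hxU⟩
    rw [hnew, Finset.card_insert_of_notMem hC₀s]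
    constructor
    · -- submodularity
      have hsub := M.eRk_inter_add_eRk_union_le C₀ U
      rw [hinter, hx.eRk_eq, eRk_eq_two_of_mem_trianglesThrough M hC₀] at hsub
      have hneU : M.eRk (C₀ ∪ U) ≠ ⊤ :=
        ((M.eRk_le_encard _).trans_lt (hC₀fin.union hUfin).encard_lt_top).ne
      have hneU' : M.eRk U ≠ ⊤ := ((M.eRk_le_encard _).trans_lt hUfin.encard_lt_top).ne
      obtain ⟨a, ha⟩ := ENat.ne_top_iff_exists.1 hneU
      obtain ⟨b, hb⟩ := ENat.ne_top_iff_exists.1 hneU'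
      rw [← ha, ← hb] at hsub
      rw [← hb] at ihr
      rw [← ha]
      have h1 : 1 + a ≤ 2 + b := by exact_mod_cast hsub
      have h2 : b ≤ 1 + s.card := by exact_mod_cast ihr
      have h3 : a ≤ 1 + (s.card + 1) := by omega
      exact_mod_cast h3
    · -- cardinality
      have hdiff : C₀ \ U = C₀ \ {x} := by rw [← hinter, Set.sdiff_self_inter]
      have hsplit : C₀ ∪ U = U ∪ (C₀ \ U) := by rw [Set.union_sdiff_self, Set.union_comm]
      rw [hsplit, Set.ncard_union_eq Set.disjoint_sdiff_right hUfin (hC₀fin.sdiff), ihc, hdiff,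
        Set.ncard_sdiff_singleton_of_mem hC₀.2.2, hC₀.2.1]
      ring

/-- **The triangles through a point are at most the nullity**: if `|E| = r(E) + d` and every rank-`2` set has
`≤ 3` elements, then at most `d` triangles pass through any non-loop `x`. -/
theorem ncard_trianglesThrough_le (M : Matroid α) [M.Finite]
    (hC1 : ∀ L ⊆ M.E, M.eRk L = 2 → L.ncard ≤ 3) {x : α} (hx : M.IsNonloop x) {d : ℕ}
    (hd : M.E.encard = M.eRank + d) : (trianglesThrough M x).ncard ≤ d := by
  classical
  have hTfin : (trianglesThrough M x).Finite :=
    M.ground_finite.finite_subsets.subset (fun C hC => hC.1.subset_ground)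
  set s := hTfin.toFinset with hsdef
  have hs : ∀ C ∈ s, C ∈ trianglesThrough M x := fun C hC => (Set.Finite.mem_toFinset hTfin).1 hC
  have hscard : s.card = (trianglesThrough M x).ncard := by
    rw [hsdef, ← Set.ncard_eq_toFinset_card _ hTfin]
  obtain ⟨hr, hc⟩ := eRk_le_and_ncard_eq_of_triangles M hC1 hx s hs
  set U : Set α := {x} ∪ ⋃ C ∈ s, C with hU
  have hUE : U ⊆ M.E := by
    intro z hz
    rcases hz with hz | hz
    · rw [Set.mem_singleton_iff.1 hz]; exact hx.mem_ground
    · obtain ⟨C, hC, hzC⟩ := Set.mem_iUnion₂.1 hz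
      exact (hs C hC).1.subset_ground hzC
  have hUfin : U.Finite := M.ground_finite.subset hUE
  -- `r(E) ≤ r(U) + |E ∖ U|`
  have hrE : M.eRank ≤ M.eRk U + (M.E \ U).encard := by
    have := M.eRk_union_le_eRk_add_encard U (M.E \ U)
    rwa [Set.union_sdiff_cancel hUE, M.eRk_ground] at this
  have hcard : M.E.ncard = U.ncard + (M.E \ U).ncard := by
    conv_lhs => rw [← Set.union_sdiff_cancel hUE]
    exact Set.ncard_union_eq Set.disjoint_sdiff_right hUfin (M.ground_finite.sdiff)
  -- pass to `ℕ`
  have hneU : M.eRk U ≠ ⊤ := ((M.eRk_le_encard _).trans_lt hUfin.encard_lt_top).ne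
  obtain ⟨a, ha⟩ := ENat.ne_top_iff_exists.1 hneU
  have hneR : M.eRank ≠ ⊤ :=
    (M.eRank_le_encard_ground.trans_lt M.ground_finite.encard_lt_top).ne
  obtain ⟨r, hr'⟩ := ENat.ne_top_iff_exists.1 hneR
  rw [← ha, ← hr', ← (M.ground_finite.sdiff (t := U)).cast_ncard_eq] at hrE
  rw [← ha] at hr
  rw [← hr', ← M.ground_finite.cast_ncard_eq] at hd
  have e1 : r ≤ a + (M.E \ U).ncard := by exact_mod_cast hrE
  have e2 : a ≤ 1 + s.card := by exact_mod_cast hr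
  have e3 : M.E.ncard = r + d := by exact_mod_cast hd
  rw [← hscard]
  omega

/-- The triangles (circuits with exactly `3` elements) of `M`. -/
def triangles (M : Matroid α) : Set (Set α) := {C : Set α | M.IsCircuit C ∧ C.ncard = 3}

/-- **Double count**: `3·#triangles ≤ |⋃ triangles| · d` when `|E| = r(E) + d` and (C1) holds — every point of the
union lies on at most `d` triangles, and every triangle is counted three times. -/
theorem three_mul_ncard_triangles_le (M : Matroid α) [M.Finite]
    (hC1 : ∀ L ⊆ M.E, M.eRk L = 2 → L.ncard ≤ 3) {d : ℕ} (hd : M.E.encard = M.eRank + d) :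
    3 * (triangles M).ncard ≤ (⋃₀ triangles M).ncard * d := by
  classical
  have hTfin : (triangles M).Finite :=
    M.ground_finite.finite_subsets.subset (fun C hC => hC.1.subset_ground)
  have hUE : ⋃₀ triangles M ⊆ M.E := by
    intro z hz
    obtain ⟨C, hC, hzC⟩ := Set.mem_sUnion.1 hz
    exact hC.1.subset_ground hzC
  have hUfin : (⋃₀ triangles M).Finite := M.ground_finite.subset hUE
  set Tf : Finset (Set α) := hTfin.toFinset with hTf
  set Uf : Finset α := hUfin.toFinset with hUf
  have hmemT : ∀ C, C ∈ Tf ↔ C ∈ triangles M := fun C => Set.Finite.mem_toFinset hTfin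
  have hmemU : ∀ x, x ∈ Uf ↔ x ∈ ⋃₀ triangles M := fun x => Set.Finite.mem_toFinset hUfin
  -- the double sum of the incidence indicator
  have hswap : ∑ x ∈ Uf, ∑ C ∈ Tf, (if x ∈ C then 1 else 0) =
      ∑ C ∈ Tf, ∑ x ∈ Uf, (if x ∈ C then 1 else 0) := Finset.sum_comm
  -- rows: every triangle has its `3` points in the union
  have hrow : ∀ C ∈ Tf, ∑ x ∈ Uf, (if x ∈ C then 1 else 0) = 3 := by
    intro C hC
    rw [Finset.sum_boole, Nat.cast_id]
    have hCT : C ∈ triangles M := (hmemT C).1 hC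
    have hCfin : C.Finite := M.ground_finite.subset hCT.1.subset_ground
    have hfilter : (Uf.filter (fun x => x ∈ C)) = hCfin.toFinset := by
      ext x
      simp only [Finset.mem_filter, Set.Finite.mem_toFinset]
      constructor
      · rintro ⟨-, hx⟩; exact hx
      · intro hx
        exact ⟨(hmemU x).2 (Set.mem_sUnion.2 ⟨C, hCT, hx⟩), hx⟩
    rw [hfilter, ← Set.ncard_eq_toFinset_card C hCfin, hCT.2]
  -- columns: at most `d` triangles through each point
  have hcol : ∀ x ∈ Uf, ∑ C ∈ Tf, (if x ∈ C then 1 else 0) ≤ d := by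
    intro x hx
    rw [Finset.sum_boole, Nat.cast_id]
    have hxU : x ∈ ⋃₀ triangles M := (hmemU x).1 hx
    obtain ⟨C₀, hC₀, hxC₀⟩ := Set.mem_sUnion.1 hxU
    -- `x` is not a loop: `{x}` is a proper subset of the circuit `C₀`
    have hx_nonloop : M.IsNonloop x := by
      rw [← _root_.Matroid.indep_singleton]
      refine hC₀.1.ssubset_indep ?_
      refine (Set.singleton_subset_iff.2 hxC₀).ssubset_of_ne ?_
      intro h
      have := congrArg Set.ncard h
      rw [Set.ncard_singleton, hC₀.2] at this
      omega
    have hfilter : ((Tf.filter (fun C => x ∈ C)) : Set (Set α)) = trianglesThrough M x := by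
      ext C
      simp only [Finset.coe_filter, Set.mem_setOf_eq, hmemT, triangles, trianglesThrough]
      tauto
    have hcard : (Tf.filter (fun C => x ∈ C)).card = (trianglesThrough M x).ncard := by
      rw [← hfilter, Set.ncard_coe_finset]
    rw [hcard]
    exact ncard_trianglesThrough_le M hC1 hx_nonloop hd
  have hleft : ∑ C ∈ Tf, ∑ x ∈ Uf, (if x ∈ C then 1 else 0) = 3 * (triangles M).ncard := by
    rw [Finset.sum_congr rfl hrow, Finset.sum_const, smul_eq_mul, hTf, ← Set.ncard_eq_toFinset_card _ hTfin,
      mul_comm]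
  have hright : ∑ x ∈ Uf, ∑ C ∈ Tf, (if x ∈ C then 1 else 0) ≤ (⋃₀ triangles M).ncard * d := by
    calc ∑ x ∈ Uf, ∑ C ∈ Tf, (if x ∈ C then 1 else 0) ≤ ∑ _x ∈ Uf, d := Finset.sum_le_sum hcol
      _ = (⋃₀ triangles M).ncard * d := by
        rw [Finset.sum_const, smul_eq_mul, hUf, ← Set.ncard_eq_toFinset_card _ hUfin]
  rw [← hleft, ← hswap]
  exact hright

/-- **`s₃ ≤ d²`**: under (C1), a finite matroid with `|E| = r(E) + d` has at most `d²` triangles (the union of the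
triangles lies in the union of the circuits with `≤ 3` elements, which has `≤ 3d` elements by Corollary N′). -/
theorem ncard_triangles_le_sq (M : Matroid α) [M.Finite]
    (hC1 : ∀ L ⊆ M.E, M.eRk L = 2 → L.ncard ≤ 3) {d : ℕ} (hd : M.E.encard = M.eRank + d) :
    (triangles M).ncard ≤ d * d := by
  have h1 := three_mul_ncard_triangles_le M hC1 hd
  have hsub : ⋃₀ triangles M ⊆ ⋃₀ PercRepro.Matroid.circuitsLE M 3 := by
    apply Set.sUnion_subset_sUnion
    intro C hC
    refine ⟨hC.1, ?_⟩
    have hfin : C.Finite := M.ground_finite.subset hC.1.subset_ground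
    rw [← hfin.cast_ncard_eq, hC.2]
  have hUE : ⋃₀ PercRepro.Matroid.circuitsLE M 3 ⊆ M.E := by
    intro z hz
    obtain ⟨C, hC, hzC⟩ := Set.mem_sUnion.1 hz
    exact PercRepro.Matroid.subset_ground_of_mem_circuitsLE hC hzC
  have hUfin : (⋃₀ PercRepro.Matroid.circuitsLE M 3).Finite := M.ground_finite.subset hUE
  have h2 : (⋃₀ triangles M).ncard ≤ 3 * d := by
    have h := PercRepro.Matroid.encard_sUnion_circuitsLE_le (M := M) (k := 3) hd
    rw [← hUfin.cast_ncard_eq] at h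
    have h' : (⋃₀ PercRepro.Matroid.circuitsLE M 3).ncard ≤ 3 * d := by exact_mod_cast h
    exact (Set.ncard_le_ncard hsub hUfin).trans h'
  have h3 : 3 * (triangles M).ncard ≤ 3 * (d * d) := by
    calc 3 * (triangles M).ncard ≤ (⋃₀ triangles M).ncard * d := h1
      _ ≤ 3 * d * d := Nat.mul_le_mul_right d h2
      _ = 3 * (d * d) := by ring
  exact Nat.le_of_mul_le_mul_left h3 (by norm_num)

/-- **`s₃(S) ≤ ν(S)²` for a subset**: the triangles of `M` inside `S ⊆ E` number at most `ν(S)²` where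
`|S| = r(S) + ν(S)`, under (C1) — the form used on the small-circuit union `S₀` of the core (restriction to `S`). -/
theorem ncard_triangles_subset_le_sq (M : Matroid α) [M.Finite]
    (hC1 : ∀ L ⊆ M.E, M.eRk L = 2 → L.ncard ≤ 3) {S : Set α} (hS : S ⊆ M.E) {d : ℕ}
    (hd : S.encard = M.eRk S + d) :
    {C : Set α | M.IsCircuit C ∧ C.ncard = 3 ∧ C ⊆ S}.ncard ≤ d * d := by
  haveI : (M.restrict S).Finite := _root_.Matroid.restrict_finite (M.ground_finite.subset hS)
  have hC1' : ∀ L ⊆ (M.restrict S).E, (M.restrict S).eRk L = 2 → L.ncard ≤ 3 := by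
    intro L hL hr
    rw [_root_.Matroid.restrict_ground_eq] at hL
    rw [_root_.Matroid.restrict_eRk_eq M hL] at hr
    exact hC1 L (hL.trans hS) hr
  have hd' : (M.restrict S).E.encard = (M.restrict S).eRank + d := by
    rw [_root_.Matroid.restrict_ground_eq, _root_.Matroid.eRank_def, _root_.Matroid.restrict_ground_eq,
      _root_.Matroid.restrict_eRk_eq M (subset_refl S), hd]
  have h := ncard_triangles_le_sq (M.restrict S) hC1' hd'
  have heq : triangles (M.restrict S) = {C : Set α | M.IsCircuit C ∧ C.ncard = 3 ∧ C ⊆ S} := by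
    ext C
    simp only [triangles, Set.mem_setOf_eq, _root_.Matroid.restrict_isCircuit_iff hS]
    tauto
  rw [heq] at h
  exact h

/-- **On the core** (simple, every element with an `e`-free partition — the hypothesis of the wrapper `rls_succ_all`),
the triangles inside any `S ⊆ E` with `|S| = r(S) + ν` number at most `ν²`: (C1) from `ncard_le_three_of_eRk_two`. -/
theorem core_ncard_triangles_subset_le_sq (M : Matroid α) [M.Finite]
    (hs : ∀ e ∈ M.E, ∀ f ∈ M.E, e ≠ f → M.eRk {e, f} = 2)
    (hfree : ∀ e ∈ M.E, ∃ A ⊆ M.E \ {e}, e ∉ M.closure A ∧ e ∉ M.closure ((M.E \ {e}) \ A))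
    {S : Set α} (hS : S ⊆ M.E) {d : ℕ} (hd : S.encard = M.eRk S + d) :
    {C : Set α | M.IsCircuit C ∧ C.ncard = 3 ∧ C ⊆ S}.ncard ≤ d * d :=
  ncard_triangles_subset_le_sq M (fun _ hL hr => ncard_le_three_of_eRk_two M hs hfree hL hr) hS hd

end ThmN

end PercRepro
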